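import Literature.AnabelianGeometry.AbsoluteAnabelian.AbsTopII.EllipticCuspidalizationCanonical
import Literature.AnabelianGeometry.Anabelioids.Basic

/-!
# [AbsTopII] Cor 3.3 (iii)(a): the v1 pin `RealizesChainPinned` is UNSATISFIABLE for `N ≥ 2` (finding F-L4t6g7-1)

S. Mochizuki, *Topics in Absolute Anabelian Geometry II* [AbsTopII] (bib `MochizukiAbsTopII2013`), §3,
Ex 3.2 (i)(ii) pp. 66–67, Cor 3.3 (iii)(a) p. 68; [AbsTopI] (`MochizukiAbsTopI2012`) Def 4.2 (iii)
pp. 49–50 (rigidifying homomorphisms; (c) "a cuspidal decomposition group `C` in `Δ_j` such that `C` is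
contained in some normal open torsion-free subgroup of `Δ_j`").

PROOF-ONLY companion (no definition), abc-iut-L4-t6 lineage (typer of record of
`EllipticCuspidalization.RealizesChain`, p433376), kernel certificate of FINDING F-L4t6g7-1 against the v1
refinement `EllipticCuspidalization.RealizesChainPinned` (abc-iut-L4-t4,
`AbsTopII/EllipticCuspidalizationCanonical.lean` p443511; successor `RealizesChainPinned'` in the same
file, whose intrinsic ⋏-pin this lineage proposed).  The v1 pin identifies the ⋏-source term `Π_{s−1}`
with the third-to-last term `Π_t` by an isomorphism `ω` COMPATIBLE WITH THE RIGIDIFYING HOMOMORPHISMS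
(`RigCompat`).  In the genuine chain `X ⇝ V ⇝ D ⇝ U ⇝ •⋯• ⇝ D` of Ex 3.2 (ii) both slots are `Π_D`, but
as DIFFERENT sub-quotients of `Π̃` (through `[N]_D : U → D` and through `U ⊆ D`); formally, chaining the
`RigCompat` opens gives `ω ∘ ι = (•-composite)` on an OPEN subgroup of `Π_s`, so the (3_Π) group `D` of
the first de-cuspidalization (contained in its kernel) meets an open subgroup trivially, hence is finite,
hence trivial by (c)'s torsion-free clause — contradicting `J ≠ ⊥` in `cuspidalDecompGroups`.  So

* `EllipticCuspidalization.not_realizesChainPinned_of_two_le` — for `2 ≤ K.N` (at least one • step),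
  `¬ K.RealizesChainPinned S CD hP hΔ hne H` for EVERY `H`: the v1 predicate is empty at ALL data;
* `EllipticDatumModel.not_isCanonicalOutput_of_two_le` — hence no v1-canonical output for any setting of
  level `≥ 2`; `cor_3_3_iii'''_no_setting_of_two_le` — the v1 `Cor_3_3_iii‴` holds only at data with NO
  setting of level `≥ 2` below some open `G₀` (vacuously), never at the intended data.

Nothing of p443511 is edited; the v2 decls `RealizesChainPinned'` / `IsCanonicalOutput'` / `Cor_3_3_iii⁗`
/ `Cor_3_4″` are the statements of record.  HONEST FRAMING: a statement about OUR v1 typing; nothing in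
print is contradicted; no side taken on [IUTchIII] Cor 3.12; typed ≠ proved.
-/

open CategoryTheory Topology
open scoped Pointwise

universe u

namespace Literature.AnabelianGeometry.AbsoluteAnabelian

open Literature.AlgebraicGeometry.Frobenioids (IsSlimGroup)

/-! ## Group-theoretic preliminaries -/

/-- An open subgroup of a compact topological group has finite index (local copy of the classical fact,
cf. `AbsTopIChainsRemark422`). [cite: MochizukiAbsTopI2012, Def 4.2 (iii) p.49] -/
private theorem finiteIndex_of_isOpen_of_compact' {G : Type u} [Group G] [TopologicalSpace G]
    [IsTopologicalGroup G] [CompactSpace G] (H : Subgroup G) (hH : IsOpen (H : Set G)) :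
    H.FiniteIndex := by
  haveI : DiscreteTopology (G ⧸ H) := QuotientGroup.discreteTopology hH
  haveI : Finite (G ⧸ H) := finite_of_compact_of_discrete
  exact Subgroup.finiteIndex_of_finite_quotient

/-- A subgroup meeting a finite-index subgroup trivially is finite (it embeds in the coset space).
[cite: MochizukiAbsTopI2012, Def 4.2 (iii) p.49] -/
private theorem finite_of_inf_eq_bot {G : Type u} [Group G] (D O : Subgroup G) [O.FiniteIndex]
    (h : D ⊓ O = ⊥) : Finite D := by
  refine Finite.of_injective (fun d : D => (QuotientGroup.mk (d : G) : G ⧸ O)) ?_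
  intro a b hab
  have hmem : ((a : G)⁻¹ * b) ∈ D ⊓ O :=
    ⟨D.mul_mem (D.inv_mem a.2) b.2, QuotientGroup.eq.mp hab⟩
  rw [h, Subgroup.mem_bot] at hmem
  exact Subtype.ext (inv_mul_eq_one.mp hmem)

/-- A finite subgroup of a torsion-free subgroup is trivial. [cite: MochizukiAbsTopI2012, Def 4.2 (iii)(c) p.50] -/
private theorem eq_bot_of_finite_of_le_torsionFree {G : Type u} [Group G] {D N : Subgroup G}
    [Finite D] (hDN : D ≤ N) (htf : ∀ g : N, IsOfFinOrder g → g = 1) : D = ⊥ := by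
  rw [eq_bot_iff]
  intro d hd
  obtain ⟨n, hn, hdn⟩ := (isOfFinOrder_iff_pow_eq_one.mp (isOfFinOrder_of_finite (⟨d, hd⟩ : D)))
  have hdn' : d ^ n = 1 := by
    have := congrArg Subtype.val hdn
    simpa using this
  have hy : (⟨d, hDN hd⟩ : N) = 1 :=
    htf ⟨d, hDN hd⟩ (isOfFinOrder_iff_pow_eq_one.mpr ⟨n, hn, Subtype.ext (by simpa using hdn')⟩)
  exact Subgroup.mem_bot.mpr (congrArg Subtype.val hy)

namespace FundamentalExtension

variable {E : FundamentalExtension.{u}}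

namespace ChainGroup

/-- **(3_Π) cuspidal decomposition groups are nontrivial**: a member `D` of
`L.cuspidalDecompGroups CD` contains the nontrivial image `J` whose commensurator defines it (`J ⊆ Δⱼ`
by the compatibility `proj ∘ ρⱼ = aug`, and `J ≤ C_{Δⱼ}(J)`). [cite: MochizukiAbsTopI2012, Def 4.2 (iii) p.49] -/
theorem ne_bot_of_mem_cuspidalDecompGroups {L : E.ChainGroup} {CD : CuspidalData E}
    {D : Subgroup L.grp} (hD : D ∈ L.cuspidalDecompGroups CD) : D ≠ ⊥ := by
  obtain ⟨x, g, hJD⟩ := hD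
  obtain ⟨hJ, hDeq⟩ := hJD
  intro hbot
  apply hJ
  rw [eq_bot_iff]
  intro y hy
  have hyΔ : y ∈ L.geomJ := by
    obtain ⟨w, hw, rfl⟩ := Subgroup.mem_map.mp hy
    rw [Subgroup.mem_subgroupOf, Subgroup.mem_inf] at hw
    change L.proj.toMonoidHom (L.rig w) = 1
    have h1 : E.aug (w : E.arith) = 1 := (FundamentalExtension.mem_geom E).mp hw.2
    have h2 := L.comm w
    change L.proj (L.rig w) = 1
    rw [h2, h1]
  have hyD : y ∈ D := by
    rw [hDeq, Subgroup.mem_map]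
    refine ⟨⟨y, hyΔ⟩, ?_, rfl⟩
    apply Literature.AnabelianGeometry.Anabelioids.le_commensurator
    rw [Subgroup.mem_subgroupOf]
    exact hy
  rw [hbot] at hyD
  exact hyD

end ChainGroup

namespace PiChain

variable {CD : CuspidalData E} {hP : IsSlimGroup E.arith} {hΔ : IsSlimGroup E.geom} {hne : E.geom ≠ ⊥}

/-- **Transport of the rigidifying homomorphisms along a •-block.**  If `ψ` tracks the operation
homomorphisms `φⱼ : Πⱼ ↠ Πⱼ₊₁` for `s ≤ j < t` starting from `ψ_s = e : P ⥲ Π_s`, then for every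
`s ≤ k ≤ t` the rigidifying homomorphisms satisfy `ρ_k = ψ_k ∘ e⁻¹ ∘ ρ_s` on an OPEN subgroup of `Π`
(chaining the compatibilities "`φⱼ ∘ ρⱼ = ρⱼ₊₁` on an open subgroup" of [AbsTopI] Def 4.2 (iii)).
[cite: MochizukiAbsTopI2012, Def 4.2 (iii) p.49] -/
theorem exists_open_rig_eq_psi (c : E.PiChain CD hP hΔ hne) {P : Type u} [Group P]
    [TopologicalSpace P] (s t : Fin (c.len + 1)) (e : P ≃ₜ* (c.term s).grp)
    (ψ : ∀ i : Fin (c.len + 1), P →* (c.term i).grp) (hψs : ∀ x, ψ s x = e x)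
    (hsteps : ∀ j : Fin c.len, s.val ≤ j.val → j.val < t.val →
      ∃ φ : (c.term j.castSucc).grp →ₜ* (c.term j.succ).grp,
        ChainGroup.IsDeCuspVia CD (c.term j.castSucc) (c.term j.succ) φ ∧
          ∀ x, ψ j.succ x = φ (ψ j.castSucc x))
    (d : ℕ) (k : Fin (c.len + 1)) (hk : k.val = s.val + d) (hkt : k.val ≤ t.val) :
    ∃ W : Subgroup E.arith, IsOpen (W : Set E.arith) ∧ W ≤ (c.term s).dom ∧ W ≤ (c.term k).dom ∧
      ∀ (w : E.arith) (hws : w ∈ (c.term s).dom) (hwk : w ∈ (c.term k).dom), w ∈ W →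
        (c.term k).rig ⟨w, hwk⟩ = ψ k (e.symm ((c.term s).rig ⟨w, hws⟩)) := by
  induction d generalizing k with
  | zero =>
    have hks : k = s := Fin.ext (by omega)
    subst hks
    refine ⟨(c.term k).dom, (c.term k).isOpen_dom, le_rfl, le_rfl, fun w hws hwk _ => ?_⟩
    rw [hψs, ContinuousMulEquiv.apply_symm_apply]
  | succ d ih =>
    have hjlt : s.val + d < c.len := by omega
    set j : Fin c.len := ⟨s.val + d, hjlt⟩ with hj
    obtain ⟨W, hWo, hWs, hWk, hW⟩ := ih j.castSucc rfl (by simp [j]; omega)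
    obtain ⟨φ, hde, hψj⟩ := hsteps j (by simp [j]) (by simp [j]; omega)
    obtain ⟨U, hUo, hU, hU', hcompat⟩ := hde.2.1
    have hjk : j.succ = k := Fin.ext (by simp [j]; omega)
    subst hjk
    refine ⟨W ⊓ U, ?_, inf_le_left.trans hWs, inf_le_right.trans hU', fun w hws hwk hw => ?_⟩
    · rw [Subgroup.coe_inf]
      exact hWo.inter hUo
    have h1 := hcompat ⟨w, hw.2⟩
    have h2 := hW w hws (hU hw.2) hw.1
    rw [hψj, ← h2]
    exact h1.symm

/-- **Kernel propagation along a •-block**: with `ψ` as above, whatever the first operation homomorphism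
`φ_s` kills stays killed: `φ_s (e x) = 1 ⇒ ψ_k x = 1` for `s + 1 ≤ k ≤ t`.
[cite: MochizukiAbsTopI2012, Def 4.2 (iii)(c) p.50] -/
theorem psi_eq_one_of_first_step (c : E.PiChain CD hP hΔ hne) {P : Type u} [Group P]
    [TopologicalSpace P] (s t : Fin (c.len + 1)) (e : P ≃ₜ* (c.term s).grp)
    (ψ : ∀ i : Fin (c.len + 1), P →* (c.term i).grp)
    (hsteps : ∀ j : Fin c.len, s.val ≤ j.val → j.val < t.val →
      ∃ φ : (c.term j.castSucc).grp →ₜ* (c.term j.succ).grp,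
        ChainGroup.IsDeCuspVia CD (c.term j.castSucc) (c.term j.succ) φ ∧
          ∀ x, ψ j.succ x = φ (ψ j.castSucc x))
    (hs1 : s.val + 1 < c.len + 1) {Q : Type u} [Group Q] [TopologicalSpace Q]
    (φs : (c.term s).grp →ₜ* Q) (hφs : ∀ x, φs (e x) = 1 → ψ ⟨s.val + 1, hs1⟩ x = 1)
    (d : ℕ) (k : Fin (c.len + 1)) (hk : k.val = s.val + 1 + d) (hkt : k.val ≤ t.val)
    (x : P) (hx : φs (e x) = 1) : ψ k x = 1 := by
  induction d generalizing k with
  | zero =>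
    have hk' : k = ⟨s.val + 1, hs1⟩ := Fin.ext (by simp; omega)
    subst hk'
    exact hφs x hx
  | succ d ih =>
    have hjlt : s.val + 1 + d < c.len := by omega
    set j : Fin c.len := ⟨s.val + 1 + d, hjlt⟩ with hj
    have h1 : ψ j.castSucc x = 1 := ih j.castSucc rfl (by simp [j]; omega)
    obtain ⟨φ, -, hψj⟩ := hsteps j (by simp [j]; omega) (by simp [j]; omega)
    have hjk : j.succ = k := Fin.ext (by simp [j]; omega)
    subst hjk
    rw [hψj, h1, map_one]

end PiChain

end FundamentalExtension

namespace AbsTopII.EllipticCuspidalization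

open FundamentalExtension

variable {E : FundamentalExtension.{u}} (K : EllipticCuspidalization E) (S : Set ℕ)
  (CD : CuspidalData E) (hP : IsSlimGroup E.arith) (hΔ : IsSlimGroup E.geom) (hne : E.geom ≠ ⊥)

/-- **Finding F-L4t6g7-1 in the kernel: the v1 pin is unsatisfiable for `N ≥ 2`.**  For every
`EllipticCuspidalization` `K` with `2 ≤ K.N` (so the recorded •-block `Π_U ↠ ⋯ ↠ Π_D` has at least one
step) and every candidate subgroup `H`, `¬ K.RealizesChainPinned S CD hP hΔ hne H`: the clause
"`ω : Π_{s−1} ⥲ Π_t` compatible with the rigidifying homomorphisms" forces `ω ∘ ι` (injective) to agree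
with the •-composite (non-injective on the (3_Π) group of the first step) on an open subgroup of `Π_s`,
whence that cuspidal decomposition group is finite, hence trivial by (c)'s torsion-free clause — against
(3_Π).  At ALL data, not only at genuine chains. [cite: MochizukiAbsTopII2013, Cor 3.3 (iii)(a) p.68] -/
theorem not_realizesChainPinned_of_two_le (h2 : 2 ≤ K.N) (H : Subgroup K.core.arith) :
    ¬ K.RealizesChainPinned S CD hP hΔ hne H := by
  rintro ⟨c, -, -, -, s, t, v, hst, htv, hvl, eU, eD, eV, gU, gD, gV, ψ, -, -, -, hψs, hsteps, -,
    r, hrs, ω, ι, γ, hω, hωrig, hι, -, hιrig, -⟩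
  -- `N ≥ 2` gives at least one • step: `s < t`
  have hN : 1 ≤ K.N ^ 2 - 1 := by
    have : 2 ^ 2 ≤ K.N ^ 2 := Nat.pow_le_pow_left h2 2
    omega
  have hlt : s.val < t.val := by omega
  have hslen : s.val < c.len := by omega
  -- the first • step `φs : Π_s ↠ Π_{s+1}` with its (3_Π) group `D`
  set js : Fin c.len := ⟨s.val, hslen⟩ with hjs
  obtain ⟨φs, hde, hψ1⟩ := hsteps js (le_refl _) hlt
  obtain ⟨-, -, D, hDmem, hker, N, -, -, -, htf, hDN⟩ := hde
  have hDker : ∀ y ∈ D, φs y = 1 := by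
    intro y hy
    have hy' : y ∈ φs.toMonoidHom.ker := by
      rw [hker]
      exact Subgroup.le_topologicalClosure _ (Subgroup.le_normalClosure hy)
    exact hy'
  -- `φs (eU x) = 1 ⇒ ψ_{s+1} x = 1`
  have hs1 : s.val + 1 < c.len + 1 := by omega
  have hφs : ∀ x, φs (eU x) = 1 → ψ js.succ x = 1 := by
    intro x hx
    have hcast : ψ js.castSucc x = eU x := hψs x
    rw [hψ1 x, hcast, hx]
  -- transport of rigidifying homomorphisms to `Π_t`, and the two pin compatibilities
  obtain ⟨W₀, hW₀o, hW₀s, hW₀t, hW₀⟩ :=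
    c.exists_open_rig_eq_psi s t eU ψ hψs hsteps (K.N ^ 2 - 1) t hst.symm le_rfl
  obtain ⟨U₁, hU₁o, hU₁s, hU₁r, hιc⟩ := hιrig
  obtain ⟨U₂, hU₂o, hU₂r, hU₂t, hωc⟩ := hωrig
  set W : Subgroup E.arith := W₀ ⊓ U₁ ⊓ U₂ with hW
  have hWo : IsOpen (W : Set E.arith) := by
    rw [hW, Subgroup.coe_inf, Subgroup.coe_inf]
    exact (hW₀o.inter hU₁o).inter hU₂o
  have hWs : W ≤ (c.term s).dom := (inf_le_left.trans inf_le_left).trans hW₀s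
  -- the open subgroup `O = ρ_s(W)` of `Π_s` meets `D` trivially
  set O : Subgroup (c.term s).grp :=
    (W.subgroupOf (c.term s).dom).map (c.term s).rig.toMonoidHom with hO
  have hDO : D ⊓ O = ⊥ := by
    rw [eq_bot_iff]
    rintro y ⟨hyD, hyO⟩
    obtain ⟨w, hwW, rfl⟩ := Subgroup.mem_map.mp hyO
    rw [Subgroup.mem_subgroupOf] at hwW
    have hw₀ : (w : E.arith) ∈ W₀ := hwW.1.1
    have hw₁ : (w : E.arith) ∈ U₁ := hwW.1.2
    have hw₂ : (w : E.arith) ∈ U₂ := hwW.2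
    -- `ψ_t (eU⁻¹ (ρ_s w)) = ρ_t w = ω (ρ_r w) = ω (ι (ρ_s w))`
    have hA := hW₀ w w.2 (hU₂t hw₂) hw₀
    have hB := hωc ⟨w, hw₂⟩
    have hC := hιc ⟨w, hw₁⟩
    -- the left-hand side vanishes since `ρ_s w ∈ D ⊆ Ker φs`
    have hzero : ψ t (eU.symm ((c.term s).rig w)) = 1 := by
      refine c.psi_eq_one_of_first_step s t eU ψ hsteps hs1 φs hφs (K.N ^ 2 - 1 - 1) t
        (by omega) le_rfl _ ?_
      rw [ContinuousMulEquiv.apply_symm_apply]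
      exact hDker _ hyD
    have hw_eq : (⟨(w : E.arith), w.2⟩ : (c.term s).dom) = w := rfl
    rw [hw_eq] at hA
    have hωι : ω (ι ((c.term s).rig w)) = 1 := by
      have hC' : ι ((c.term s).rig w) = (c.term r).rig ⟨w, hU₁r hw₁⟩ := hC
      rw [hC']
      have hB' : ω ((c.term r).rig ⟨w, hU₂r hw₂⟩) = (c.term t).rig ⟨w, hU₂t hw₂⟩ := hB
      rw [hB', hA, hzero]
    have hι1 : ι ((c.term s).rig w) = 1 := hω.1 (by rw [hωι, map_one])
    have hy1 : (c.term s).rig w = 1 := hι (by rw [hι1, map_one])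
    rw [Subgroup.mem_bot]
    exact hy1
  -- `O` has finite index (`W` open of finite index in `Π`; `ρ_s` has open range), so `D` is finite
  haveI hWfi : W.FiniteIndex := finiteIndex_of_isOpen_of_compact' W hWo
  haveI : (W.subgroupOf (c.term s).dom).FiniteIndex := inferInstance
  have hR : (c.term s).rig.toMonoidHom.range.FiniteIndex := by
    refine finiteIndex_of_isOpen_of_compact' _ ?_
    rw [MonoidHom.coe_range]
    exact (c.term s).isOpen_range_rig
  haveI hOfi : O.FiniteIndex := by
    rw [Subgroup.finiteIndex_iff, hO, Subgroup.index_map]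
    exact mul_ne_zero (Subgroup.finiteIndex_of_le le_sup_left).index_ne_zero hR.index_ne_zero
  haveI : Finite D := @finite_of_inf_eq_bot _ _ D O hOfi hDO
  -- finite inside the torsion-free `N`: trivial — contradicting (3_Π)
  exact ChainGroup.ne_bot_of_mem_cuspidalDecompGroups hDmem
    (eq_bot_of_finite_of_le_torsionFree hDN htf)

end AbsTopII.EllipticCuspidalization

namespace AbsTopII.EllipticDatumModel

open FundamentalExtension
open AbsTopI (ConstructionDataClass)

variable {𝒟 : ConstructionDataClass.{u}} (M : EllipticDatumModel 𝒟)

/-- **No v1-canonical output at level `≥ 2`.**  `IsCanonicalOutput h s K` (v1, p443511) requires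
`Matches s K` (so `K.N = s.level`) and the v1 pin; by `not_realizesChainPinned_of_two_le` it is EMPTY for
every setting of level `≥ 2` — at all data.  (The statement of record is `IsCanonicalOutput'`.)
[cite: MochizukiAbsTopII2013, Cor 3.3 (iii) pp.68-69] -/
theorem not_isCanonicalOutput_of_two_le {b : 𝒟.Base} {X : (𝒟.datum b).Obj} (h : M.IsCor33Member b X)
    {C : (𝒟.datum b).Obj} {f : (𝒟.datum b).Hom X C} (s : M.Setting b X C f)
    (K : EllipticCuspidalization ((𝒟.datum b).ext X)) (h2 : 2 ≤ s.level) :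
    ¬ M.IsCanonicalOutput h s K := by
  rintro ⟨hM, e, x, -, -, hpin⟩
  have hN : 2 ≤ K.N := by
    rw [hM.1]
    exact h2
  exact K.not_realizesChainPinned_of_two_le _ _ _ _ _ hN _ hpin

/-- **What the v1 `Cor_3_3_iii‴` can hold at**: if it holds (with the `𝒟`-hypotheses), then for every
member with a datum core and every level `N ≥ 2` there is an open `G₀ ⊆ G` below which NO setting of
level `N` exists — i.e. v1 (iii‴) is refuted by any member carrying settings of level `≥ 2` with
arbitrarily small `G′` (the intended data), and holds only vacuously otherwise.  Successor of record:
`Cor_3_3_iii⁗`. [cite: MochizukiAbsTopII2013, Cor 3.3 (iii) pp.68-69] -/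
theorem cor_3_3_iii'''_no_setting_of_two_le (hiii : M.Cor_3_3_iii''') (hcf : 𝒟.IsChainFull)
    (hgc : 𝒟.RelIsomDGC) {b : 𝒟.Base} {X : (𝒟.datum b).Obj} (h : M.IsCor33Member b X)
    {C : (𝒟.datum b).Obj} {f : (𝒟.datum b).Hom X C} (hf : M.IsFinEt f) (hC : M.IsCoreOf b C X)
    (N : ℕ) (hN : 2 ≤ N) :
    ∃ G₀ : Subgroup ((𝒟.datum b).ext X).gal, IsOpen (G₀ : Set ((𝒟.datum b).ext X).gal) ∧
      ∀ s : M.Setting b X C f, s.level = N → ¬ s.galOpen ≤ G₀ := by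
  obtain ⟨G₀, hG₀, hs⟩ := hiii hcf hgc b X h C f hf hC N
  refine ⟨G₀, hG₀, fun s hsN hsG => ?_⟩
  obtain ⟨K, hK⟩ := hs s hsN hsG
  exact M.not_isCanonicalOutput_of_two_le h s K (by rw [hsN]; exact hN) hK

end AbsTopII.EllipticDatumModel

end Literature.AnabelianGeometry.AbsoluteAnabelian
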